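import Mathlib
import Summits.KontsevichZagierPeriods.KontsevichZagierPeriods.Theorems.SoloInformedCoonsCellBox
import Summits.KontsevichZagierPeriods.KontsevichZagierPeriods.Theorems.SoloInformedKZGreen
import Summits.KontsevichZagierPeriods.KontsevichZagierPeriods.Theorems.SoloInformedKappaPathCongr
import HarnessLib

/-!
# SoloInformed — the Coons cell: `κ(B) + κ(R) = κ(T) + κ(L)` for four Nash edges in one chart

File I2c of the (HT) step (`SoloInformedNashHT`) of the solo-informed programme (support files
`SoloInformedCoonsPlane`, `SoloInformedChartCore`, `SoloInformedCoonsCellBox`).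

**The cell lemma** (`soloInformed_kappaPath_coons`).  Let `c` be a local holomorphic chart of the
smooth affine `ℚ̄`-curve `Z` (`SoloInformedChart`: `ψ : B = ball w₀ ε → Z(ℂ) ∩ Ω` with the graph
property `ψ(w)_{i₀} = w`), and let `e_B, e_T, e_L, e_R : ℝ → ℂⁿ` be four Nash maps
(`SoloInformedIsNashPath`) whose values on `[0,1]` lie in the *core* of the chart
(`soloInformedCore c = Z(ℂ) ∩ Ω ∩ {z | z_{i₀} ∈ ball w₀ (ε/4)}`) and which fit together at the
four corners (`e_L 0 = e_B 0`, `e_R 0 = e_B 1`, `e_L 1 = e_T 0`, `e_R 1 = e_T 1`).  Then for every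
algebraic `1`-form `ω = Σ ωⱼ dzⱼ`,
`κ(ω, e_B) + κ(ω, e_R) = κ(ω, e_T) + κ(ω, e_L)` in `V = P × P`
(`P` the ring of effective formal periods, `κ` of `SoloInformedKappaPath`).

**Proof.**  Work in the chart coordinate: `c_X = (e_X)_{i₀}` are `C¹` curves in the disc
`ball w₀ (ε/4)`, and the Coons patch `h(s,t)` of the four (`SoloInformedCoonsPatch`) maps `[0,1]²`
into `ball w₀ (3ε/4) ⊆ B` (`soloInformed_norm_coons_sub_le`), hence — by compactness — a rational
box `W = (−δ, 1 + δ)²` into `B` (`soloInformed_exists_ubox`).  The pulled-back form is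
`ψ^*ω = G(w) dw` with `G = Σⱼ ωⱼ(ψ(w)) ψⱼ′(w)` holomorphic on `B`; along `h` it has the real
coefficients `P = Re(G(h) hₛ)`, `Q = Re(G(h) hₜ)` with `Pₜ = Qₛ` (`SoloInformedCoonsForm`), line
derivatives from one-variable calculus (`SoloInformedLineDerivKit`), and — the point — `P, Q` are
`ℚ`-semialgebraic on `W`: the coordinates `φⱼ = ψⱼ ∘ h` are (`soloInformed_reImSA_chart`, the graph
property pinned by a semialgebraic window), so are their line derivatives
(`soloInformed_sa_lineDeriv`), and `G(h) hₛ = Σⱼ ωⱼ(φ) ∂ₛφⱼ`.  The line-derivative Green theorem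
in the KZ calculus (`soloInformed_kzGreen_line_toFormalPeriod`) then gives
`⟦B⟧ + ⟦R⟧ = ⟦T⟧ + ⟦L⟧` for the edge restrictions, and the edge restrictions of `P` (`Q`) are the
form integrands `Re Σⱼ ωⱼ(e_X) (e_X)ⱼ′` because `ψ(c_X) = e_X` on `[0,1]` (graph property on the
core) and `(ψⱼ ∘ c_X)′ = (e_X)ⱼ′` there (`soloInformed_deriv_congr_Icc`).  Same for `Im`.

References: Huber–Wüstholz, *Transcendence and linear relations of 1-periods* (2022), §3.3.1,
§7.2, §13.1; Bochnak–Coste–Roy, *Real algebraic geometry* (1998), §2.2, Prop. 8.1.8;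
`paper/rung2-v2.md` §4.5 of the solo-informed home.
-/

noncomputable section

open scoped BigOperators Topology
open Set Metric MvPolynomial
open Literature.NumberTheory.Transcendental Literature.NumberTheory.Transcendental.KZ
open Literature.NumberTheory.Transcendental.CurvePeriods
open Literature.ModelTheory.ExponentialFields

namespace Summit.KontsevichZagierPeriods.KontsevichZagierPeriods.Theorems

variable {Z : CurveData}

section Cell

variable {c : SoloInformedChart Z} {ω : Fin Z.n → MvPolynomial (Fin Z.n) ℂ}
  {eB eT eL eR : ℝ → Fin Z.n → ℂ} {ε δ : ℚ}

/-- **The derivative of an edge in the chart**: `ψⱼ′(c_X(s)) c_X′(s) = (e_X)ⱼ′(s)` on `[0,1]`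
(the edge runs in the core, so `ψ ∘ c_X = e_X` on `[0,1]`). -/
theorem soloInformed_deriv_edge (c : SoloInformedChart Z) {e : ℝ → Fin Z.n → ℂ} (hε : 0 < ε)
    (ne : SoloInformedNashOn ε e) (hm : ∀ u ∈ Icc (0 : ℝ) 1, e u ∈ soloInformedCore c) {s : ℝ}
    (hs : s ∈ Icc (0 : ℝ) 1) (j : Fin Z.n) :
    deriv (fun w => c.ψ w j) (soloInformedEC c.i₀ e s) * soloInformedED c.i₀ e s =
      deriv (fun u => e u j) s := by
  have hε' : (0 : ℝ) < ε := by exact_mod_cast hε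
  have hsJ : s ∈ Ioo (-(ε : ℝ)) (1 + ε) := ⟨by linarith [hs.1], by linarith [hs.2]⟩
  have hball : soloInformedEC c.i₀ e s ∈ ball c.w₀ c.ε := c.coord_mem_ball_of_mem_core (hm s hs)
  have h1 : HasDerivAt (fun u => c.ψ (soloInformedEC c.i₀ e u) j)
      (deriv (fun w => c.ψ w j) (soloInformedEC c.i₀ e s) * soloInformedED c.i₀ e s) s :=
    (c.hasDerivAt_coord hball j).comp s (soloInformed_hasDerivAt_EC ne hsJ)
  have heq : EqOn (fun u => c.ψ (soloInformedEC c.i₀ e u)) e (Icc 0 1) := fun u hu =>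
    c.psi_coord_of_mem_core (hm u hu)
  have h2 := soloInformed_deriv_congr_Icc heq j hs h1.differentiableAt
    ((ne.isNashPath hε).differentiableAt_apply hs j)
  rw [← h1.deriv]
  exact h2

/-- **Bottom edge of `P`:** `G(h(s,0)) ∂ₛh(s,0) = Σⱼ ωⱼ(e_B(s)) (e_B)ⱼ′(s)` for `s ∈ [0,1]`. -/
theorem soloInformed_cellPc_bottom (hε : 0 < ε) (nB : SoloInformedNashOn ε eB)
    (hBm : ∀ u ∈ Icc (0 : ℝ) 1, eB u ∈ soloInformedCore c) (h00 : eL 0 = eB 0) (h10 : eR 0 = eB 1)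
    {x : Fin 1 → ℝ} (hx : x ∈ soloInformedCube 1) :
    soloInformedCellPc c ω eB eT eL eR (Fin.insertNth 1 0 x) =
      soloInformedFormIntegrand ω eB (x 0) := by
  have hs : x 0 ∈ Icc (0 : ℝ) 1 := ⟨(hx 0).1, (hx 0).2⟩
  have h00' : soloInformedEC c.i₀ eL 0 = soloInformedEC c.i₀ eB 0 := by
    simp only [soloInformedEC, h00]
  have h10' : soloInformedEC c.i₀ eR 0 = soloInformedEC c.i₀ eB 1 := by
    simp only [soloInformedEC, h10]
  unfold soloInformedCellPc soloInformedCoonsPc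
  rw [soloInformed_insertNth_one_apply_zero, soloInformed_insertNth_one_apply_one,
    soloInformedCoons_bottom h00' h10', soloInformed_coonsDs_bottom h00' h10']
  unfold soloInformedChartForm soloInformedFormIntegrand
  rw [Finset.sum_mul]
  refine Finset.sum_congr rfl fun j _ => ?_
  rw [mul_assoc, soloInformed_deriv_edge c hε nB hBm hs j, c.psi_EC (hBm _ hs)]

/-- **Top edge of `P`.** -/
theorem soloInformed_cellPc_top (hε : 0 < ε) (nT : SoloInformedNashOn ε eT)
    (hTm : ∀ u ∈ Icc (0 : ℝ) 1, eT u ∈ soloInformedCore c) (h01 : eL 1 = eT 0) (h11 : eR 1 = eT 1)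
    {x : Fin 1 → ℝ} (hx : x ∈ soloInformedCube 1) :
    soloInformedCellPc c ω eB eT eL eR (Fin.insertNth 1 1 x) =
      soloInformedFormIntegrand ω eT (x 0) := by
  have hs : x 0 ∈ Icc (0 : ℝ) 1 := ⟨(hx 0).1, (hx 0).2⟩
  have h01' : soloInformedEC c.i₀ eL 1 = soloInformedEC c.i₀ eT 0 := by
    simp only [soloInformedEC, h01]
  have h11' : soloInformedEC c.i₀ eR 1 = soloInformedEC c.i₀ eT 1 := by
    simp only [soloInformedEC, h11]
  unfold soloInformedCellPc soloInformedCoonsPc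
  rw [soloInformed_insertNth_one_apply_zero, soloInformed_insertNth_one_apply_one,
    soloInformedCoons_top h01' h11', soloInformed_coonsDs_top h01' h11']
  unfold soloInformedChartForm soloInformedFormIntegrand
  rw [Finset.sum_mul]
  refine Finset.sum_congr rfl fun j _ => ?_
  rw [mul_assoc, soloInformed_deriv_edge c hε nT hTm hs j, c.psi_EC (hTm _ hs)]

/-- **Left edge of `Q`.** -/
theorem soloInformed_cellQc_left (hε : 0 < ε) (nL : SoloInformedNashOn ε eL)
    (hLm : ∀ u ∈ Icc (0 : ℝ) 1, eL u ∈ soloInformedCore c) {x : Fin 1 → ℝ}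
    (hx : x ∈ soloInformedCube 1) :
    soloInformedCellQc c ω eB eT eL eR (Fin.insertNth 0 0 x) =
      soloInformedFormIntegrand ω eL (x 0) := by
  have hs : x 0 ∈ Icc (0 : ℝ) 1 := ⟨(hx 0).1, (hx 0).2⟩
  unfold soloInformedCellQc soloInformedCoonsQc
  rw [soloInformed_insertNth_zero_apply_zero, soloInformed_insertNth_zero_apply_one,
    soloInformedCoons_left, soloInformed_coonsDt_left]
  unfold soloInformedChartForm soloInformedFormIntegrand
  rw [Finset.sum_mul]
  refine Finset.sum_congr rfl fun j _ => ?_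
  rw [mul_assoc, soloInformed_deriv_edge c hε nL hLm hs j, c.psi_EC (hLm _ hs)]

/-- **Right edge of `Q`.** -/
theorem soloInformed_cellQc_right (hε : 0 < ε) (nR : SoloInformedNashOn ε eR)
    (hRm : ∀ u ∈ Icc (0 : ℝ) 1, eR u ∈ soloInformedCore c) {x : Fin 1 → ℝ}
    (hx : x ∈ soloInformedCube 1) :
    soloInformedCellQc c ω eB eT eL eR (Fin.insertNth 0 1 x) =
      soloInformedFormIntegrand ω eR (x 0) := by
  have hs : x 0 ∈ Icc (0 : ℝ) 1 := ⟨(hx 0).1, (hx 0).2⟩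
  unfold soloInformedCellQc soloInformedCoonsQc
  rw [soloInformed_insertNth_zero_apply_zero, soloInformed_insertNth_zero_apply_one,
    soloInformedCoons_right, soloInformed_coonsDt_right]
  unfold soloInformedChartForm soloInformedFormIntegrand
  rw [Finset.sum_mul]
  refine Finset.sum_congr rfl fun j _ => ?_
  rw [mul_assoc, soloInformed_deriv_edge c hε nR hRm hs j, c.psi_EC (hRm _ hs)]

/-- **The Green identity of the cell, for one real-linear read-out** (`Re` or `Im`): all
hypotheses of `soloInformed_kzGreen_line_toFormalPeriod` are met on the rational box. -/
theorem soloInformed_cell_green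
    (hε : 0 < ε) (nB : SoloInformedNashOn ε eB) (nT : SoloInformedNashOn ε eT)
    (nL : SoloInformedNashOn ε eL) (nR : SoloInformedNashOn ε eR) (hδ0 : 0 < δ) (hδε : δ < ε)
    (hδ : ∀ z ∈ soloInformedCBox 2 (δ : ℝ), soloInformedCellH c.i₀ eB eT eL eR z ∈ ball c.w₀ c.ε)
    {P Q P_t Q_s : (Fin 2 → ℝ) → ℝ} {L : ℂ →L[ℝ] ℝ}
    (hP : ∀ z, P z = L (soloInformedCellPc c ω eB eT eL eR z))
    (hQ : ∀ z, Q z = L (soloInformedCellQc c ω eB eT eL eR z))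
    (hPt : ∀ z, P_t z = L (soloInformedCellPtc c ω eB eT eL eR z))
    (hQs : ∀ z, Q_s z = L (soloInformedCellQsc c ω eB eT eL eR z))
    (hPs : IsSemialgebraicFunOn ℚ (soloInformedUBox 2 (δ : ℝ)) P)
    (hQsa : IsSemialgebraicFunOn ℚ (soloInformedUBox 2 (δ : ℝ)) Q)
    (hPd : ∀ z ∈ soloInformedUBox 2 (δ : ℝ), HasLineDerivAt ℝ P (P_t z) z (Pi.single 1 1))
    (hQd : ∀ z ∈ soloInformedUBox 2 (δ : ℝ), HasLineDerivAt ℝ Q (Q_s z) z (Pi.single 0 1))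
    (rB rT rL rR : IntegralRep 1) (hBd : rB.domain = soloInformedCube 1)
    (hTd : rT.domain = soloInformedCube 1) (hLd : rL.domain = soloInformedCube 1)
    (hRd : rR.domain = soloInformedCube 1)
    (hBi : EqOn rB.integrand (fun s => L (soloInformedFormIntegrand ω eB (s 0))) (soloInformedCube 1))
    (hTi : EqOn rT.integrand (fun s => L (soloInformedFormIntegrand ω eT (s 0))) (soloInformedCube 1))
    (hLi : EqOn rL.integrand (fun s => L (soloInformedFormIntegrand ω eL (s 0))) (soloInformedCube 1))
    (hRi : EqOn rR.integrand (fun s => L (soloInformedFormIntegrand ω eR (s 0))) (soloInformedCube 1))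
    (hBm : ∀ u ∈ Icc (0 : ℝ) 1, eB u ∈ soloInformedCore c)
    (hTm : ∀ u ∈ Icc (0 : ℝ) 1, eT u ∈ soloInformedCore c)
    (hLm : ∀ u ∈ Icc (0 : ℝ) 1, eL u ∈ soloInformedCore c)
    (hRm : ∀ u ∈ Icc (0 : ℝ) 1, eR u ∈ soloInformedCore c)
    (h00 : eL 0 = eB 0) (h10 : eR 0 = eB 1) (h01 : eL 1 = eT 0) (h11 : eR 1 = eT 1) :
    toFormalPeriod (of rB) + toFormalPeriod (of rR) =
      toFormalPeriod (of rT) + toFormalPeriod (of rL) := by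
  have hδ0' : (0 : ℝ) < δ := by exact_mod_cast hδ0
  have hW := soloInformed_isOpen_ubox 2 (δ : ℝ)
  have hCW : soloInformedCube 2 ⊆ soloInformedUBox 2 (δ : ℝ) := soloInformed_cube_subset_ubox 2 hδ0'
  have hsub := soloInformed_ubox_subset_cbox 2 (δ : ℝ)
  have hmaps : MapsTo (soloInformedCellH c.i₀ eB eT eL eR) (soloInformedUBox 2 (δ : ℝ))
      (ball c.w₀ c.ε) := fun z hz => hδ z (hsub hz)
  have hGc : ContinuousOn (soloInformedChartForm c ω) (ball c.w₀ c.ε) :=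
    (soloInformed_analyticOnNhd_chartForm c ω).continuousOn
  have hG'c : ContinuousOn (deriv (soloInformedChartForm c ω)) (ball c.w₀ c.ε) :=
    (soloInformed_analyticOnNhd_chartForm c ω).deriv.continuousOn
  have hHc := soloInformed_continuousOn_cellH (c := c) nB nT nL nR hδε.le
  have hDsc := soloInformed_continuousOn_cellDs (c := c) nB nT nL nR hδε.le
  have hDtc := soloInformed_continuousOn_cellDt (c := c) nB nT nL nR hδε.le
  have hDstc := soloInformed_continuousOn_cellDst (c := c) nB nT nL nR hδε.le
  -- continuity of the complex coefficients
  have hPcc : ContinuousOn (soloInformedCellPc c ω eB eT eL eR) (soloInformedUBox 2 (δ : ℝ)) :=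
    ((hGc.comp hHc hmaps).mul hDsc).congr fun z _ => soloInformedCellPc_eq c ω eB eT eL eR z
  have hQcc : ContinuousOn (soloInformedCellQc c ω eB eT eL eR) (soloInformedUBox 2 (δ : ℝ)) :=
    ((hGc.comp hHc hmaps).mul hDtc).congr fun z _ => soloInformedCellQc_eq c ω eB eT eL eR z
  have hPtcc : ContinuousOn (soloInformedCellPtc c ω eB eT eL eR) (soloInformedUBox 2 (δ : ℝ)) :=
    ((((hG'c.comp hHc hmaps).mul hDtc).mul hDsc).add ((hGc.comp hHc hmaps).mul hDstc)).congr
      fun z _ => soloInformedCellPtc_eq c ω eB eT eL eR z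
  have hPc : ContinuousOn P (soloInformedUBox 2 (δ : ℝ)) :=
    (L.continuous.comp_continuousOn hPcc).congr fun z _ => hP z
  have hQc : ContinuousOn Q (soloInformedUBox 2 (δ : ℝ)) :=
    (L.continuous.comp_continuousOn hQcc).congr fun z _ => hQ z
  have hPtc : ContinuousOn P_t (soloInformedCube 2) :=
    ((L.continuous.comp_continuousOn hPtcc).congr fun z _ => hPt z).mono hCW
  have hclosed : EqOn P_t Q_s (soloInformedCube 2) := fun z _ => by
    rw [hPt, hQs]
    unfold soloInformedCellPtc soloInformedCellQsc
    rw [soloInformed_coonsPtc_eq_Qsc]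
  -- edge integrands
  have hBi' : EqOn rB.integrand (fun s => P (Fin.insertNth 1 0 s)) (soloInformedCube 1) :=
    fun x hx => by
      show rB.integrand x = P (Fin.insertNth 1 0 x)
      rw [hP, soloInformed_cellPc_bottom hε nB hBm h00 h10 hx]
      exact hBi hx
  have hTi' : EqOn rT.integrand (fun s => P (Fin.insertNth 1 1 s)) (soloInformedCube 1) :=
    fun x hx => by
      show rT.integrand x = P (Fin.insertNth 1 1 x)
      rw [hP, soloInformed_cellPc_top hε nT hTm h01 h11 hx]
      exact hTi hx
  have hLi' : EqOn rL.integrand (fun t => Q (Fin.insertNth 0 0 t)) (soloInformedCube 1) :=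
    fun x hx => by
      show rL.integrand x = Q (Fin.insertNth 0 0 x)
      rw [hQ, soloInformed_cellQc_left hε nL hLm hx]
      exact hLi hx
  have hRi' : EqOn rR.integrand (fun t => Q (Fin.insertNth 0 1 t)) (soloInformedCube 1) :=
    fun x hx => by
      show rR.integrand x = Q (Fin.insertNth 0 1 x)
      rw [hQ, soloInformed_cellQc_right hε nR hRm hx]
      exact hRi hx
  exact soloInformed_kzGreen_line_toFormalPeriod hW hCW hPs hQsa hPc hQc hPd hQd hPtc hclosed
    rB rT rL rR hBd hTd hLd hRd hBi' hTi' hLi' hRi'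

end Cell

/-! ## 6. The cell lemma -/

/-- **The Coons cell.**  For a chart `c` of the smooth affine `ℚ̄`-curve `Z`, an algebraic
`1`-form `ω`, and four Nash maps `e_B, e_T, e_L, e_R` running in the core of `c` on `[0,1]` and
fitting together at the corners (`e_L(0) = e_B(0)`, `e_R(0) = e_B(1)`, `e_L(1) = e_T(0)`,
`e_R(1) = e_T(1)`):  `κ(ω, e_B) + κ(ω, e_R) = κ(ω, e_T) + κ(ω, e_L)` in `V`.
[Huber–Wüstholz 2022, §7.2 with §13.1 (Stokes); BCR 1998, §2.2, Prop. 8.1.8] -/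
theorem soloInformed_kappaPath_coons (hZ : Z.IsSmoothAffineCurve) (c : SoloInformedChart Z)
    (ω : Fin Z.n → MvPolynomial (Fin Z.n) ℂ) (hω : ∀ i, HasAlgCoeffs (ω i))
    {eB eT eL eR : ℝ → Fin Z.n → ℂ} (hB : SoloInformedIsNashPath eB)
    (hT : SoloInformedIsNashPath eT) (hL : SoloInformedIsNashPath eL)
    (hR : SoloInformedIsNashPath eR) (hBm : ∀ u ∈ Icc (0 : ℝ) 1, eB u ∈ soloInformedCore c)
    (hTm : ∀ u ∈ Icc (0 : ℝ) 1, eT u ∈ soloInformedCore c)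
    (hLm : ∀ u ∈ Icc (0 : ℝ) 1, eL u ∈ soloInformedCore c)
    (hRm : ∀ u ∈ Icc (0 : ℝ) 1, eR u ∈ soloInformedCore c)
    (h00 : eL 0 = eB 0) (h10 : eR 0 = eB 1) (h01 : eL 1 = eT 0) (h11 : eR 1 = eT 1) :
    soloInformedKappaPath ω hω eB hB + soloInformedKappaPath ω hω eR hR =
      soloInformedKappaPath ω hω eT hT + soloInformedKappaPath ω hω eL hL := by
  obtain ⟨ε, hε, nB, nT, nL, nR⟩ := soloInformed_exists_nashOn₄ hB hT hL hR
  have hε' : (0 : ℝ) < ε := by exact_mod_cast hε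
  -- a rational box mapped by `h` into the disc
  have hHc : ContinuousOn (soloInformedCellH c.i₀ eB eT eL eR) (soloInformedUBox 2 (ε : ℝ)) :=
    soloInformed_continuousOn_cellH nB nT nL nR le_rfl
  obtain ⟨δ, hδ0, hδε, hδ⟩ := soloInformed_exists_ubox hε' hHc isOpen_ball
    (fun z hz => soloInformed_cellH_mem_ball hBm hTm hLm hRm hz)
  have hδεQ : δ < ε := by exact_mod_cast hδε
  have hδ' : ∀ z ∈ soloInformedCBox 2 (δ : ℝ),
      soloInformedCellH c.i₀ eB eT eL eR z ∈ ball c.w₀ c.ε := fun z hz => hδ z hz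
  have hsub := soloInformed_ubox_subset_cbox 2 (δ : ℝ)
  -- semialgebraicity of the complex coefficients
  obtain ⟨hPsa, hQsa⟩ := soloInformed_reImSA_cellPQ (c := c) hZ hω hε nB nT nL nR hδεQ hδ'
  -- line derivatives of the complex coefficients, real and imaginary parts
  have hGd : ∀ z ∈ soloInformedUBox 2 (δ : ℝ),
      HasDerivAt (soloInformedChartForm c ω)
        (deriv (soloInformedChartForm c ω) (soloInformedCellH c.i₀ eB eT eL eR z))
        (soloInformedCellH c.i₀ eB eT eL eR z) := fun z hz =>
    ((soloInformed_analyticOnNhd_chartForm c ω) _ (hδ' z (hsub hz))).differentiableAt.hasDerivAt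
  have hz0 : ∀ z ∈ soloInformedUBox 2 (δ : ℝ), z 0 ∈ Ioo (-(ε : ℝ)) (1 + ε) := fun z hz =>
    soloInformed_apply_mem_Ioo_of_mem_ubox hδε.le hz 0
  have hz1 : ∀ z ∈ soloInformedUBox 2 (δ : ℝ), z 1 ∈ Ioo (-(ε : ℝ)) (1 + ε) := fun z hz =>
    soloInformed_apply_mem_Ioo_of_mem_ubox hδε.le hz 1
  have hPd_re : ∀ z ∈ soloInformedUBox 2 (δ : ℝ),
      HasLineDerivAt ℝ (fun w => (soloInformedCellPc c ω eB eT eL eR w).re)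
        (soloInformedCellPtc c ω eB eT eL eR z).re z (Pi.single 1 1) := fun z hz =>
    soloInformed_hasLineDerivAt_re_coonsP (hGd z hz) (soloInformed_hasDerivAt_EC nL (hz1 z hz))
      (soloInformed_hasDerivAt_EC nR (hz1 z hz))
  have hPd_im : ∀ z ∈ soloInformedUBox 2 (δ : ℝ),
      HasLineDerivAt ℝ (fun w => (soloInformedCellPc c ω eB eT eL eR w).im)
        (soloInformedCellPtc c ω eB eT eL eR z).im z (Pi.single 1 1) := fun z hz =>
    soloInformed_hasLineDerivAt_im_coonsP (hGd z hz) (soloInformed_hasDerivAt_EC nL (hz1 z hz))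
      (soloInformed_hasDerivAt_EC nR (hz1 z hz))
  have hQd_re : ∀ z ∈ soloInformedUBox 2 (δ : ℝ),
      HasLineDerivAt ℝ (fun w => (soloInformedCellQc c ω eB eT eL eR w).re)
        (soloInformedCellQsc c ω eB eT eL eR z).re z (Pi.single 0 1) := fun z hz =>
    soloInformed_hasLineDerivAt_re_coonsQ (hGd z hz) (soloInformed_hasDerivAt_EC nB (hz0 z hz))
      (soloInformed_hasDerivAt_EC nT (hz0 z hz))
  have hQd_im : ∀ z ∈ soloInformedUBox 2 (δ : ℝ),
      HasLineDerivAt ℝ (fun w => (soloInformedCellQc c ω eB eT eL eR w).im)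
        (soloInformedCellQsc c ω eB eT eL eR z).im z (Pi.single 0 1) := fun z hz =>
    soloInformed_hasLineDerivAt_im_coonsQ (hGd z hz) (soloInformed_hasDerivAt_EC nB (hz0 z hz))
      (soloInformed_hasDerivAt_EC nT (hz0 z hz))
  -- the two Green identities
  have green_re := soloInformed_cell_green (c := c) (L := Complex.reCLM)
    (P := fun z => (soloInformedCellPc c ω eB eT eL eR z).re)
    (Q := fun z => (soloInformedCellQc c ω eB eT eL eR z).re)
    (P_t := fun z => (soloInformedCellPtc c ω eB eT eL eR z).re)
    (Q_s := fun z => (soloInformedCellQsc c ω eB eT eL eR z).re)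
    hε nB nT nL nR hδ0 hδεQ hδ' (fun _ => rfl) (fun _ => rfl) (fun _ => rfl) (fun _ => rfl)
    hPsa.1 hQsa.1 hPd_re hQd_re
    (soloInformedFormRepRe ω hω eB hB) (soloInformedFormRepRe ω hω eT hT)
    (soloInformedFormRepRe ω hω eL hL) (soloInformedFormRepRe ω hω eR hR)
    soloInformedUnitI_eq_cube soloInformedUnitI_eq_cube soloInformedUnitI_eq_cube
    soloInformedUnitI_eq_cube (fun _ _ => rfl) (fun _ _ => rfl) (fun _ _ => rfl) (fun _ _ => rfl)
    hBm hTm hLm hRm h00 h10 h01 h11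
  have green_im := soloInformed_cell_green (c := c) (L := Complex.imCLM)
    (P := fun z => (soloInformedCellPc c ω eB eT eL eR z).im)
    (Q := fun z => (soloInformedCellQc c ω eB eT eL eR z).im)
    (P_t := fun z => (soloInformedCellPtc c ω eB eT eL eR z).im)
    (Q_s := fun z => (soloInformedCellQsc c ω eB eT eL eR z).im)
    hε nB nT nL nR hδ0 hδεQ hδ' (fun _ => rfl) (fun _ => rfl) (fun _ => rfl) (fun _ => rfl)
    hPsa.2 hQsa.2 hPd_im hQd_im
    (soloInformedFormRepIm ω hω eB hB) (soloInformedFormRepIm ω hω eT hT)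
    (soloInformedFormRepIm ω hω eL hL) (soloInformedFormRepIm ω hω eR hR)
    soloInformedUnitI_eq_cube soloInformedUnitI_eq_cube soloInformedUnitI_eq_cube
    soloInformedUnitI_eq_cube (fun _ _ => rfl) (fun _ _ => rfl) (fun _ _ => rfl) (fun _ _ => rfl)
    hBm hTm hLm hRm h00 h10 h01 h11
  ext
  · simp only [SoloInformedV.fst_add, soloInformedKappaPath_fst]
    exact green_re
  · simp only [SoloInformedV.snd_add, soloInformedKappaPath_snd]
    exact green_im

end Summit.KontsevichZagierPeriods.KontsevichZagierPeriods.Theorems
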